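import Summits.QuantumFields.YangMills.Theorems.FluctuationComparisonRegPrIntLS2BetaLiftLadderOneProfileTop
import Summits.QuantumFields.YangMills.Theorems.FluctuationComparisonRegPrIntLS2BetaStageAxialCombReading
import HarnessLib

/-!
# S2β · THE SUP CHAIN — ROWS DOCK: the per-`B` rows of the one-profile LIFT-LADDER (px20 ✓p834992 `topRow'`, ✓p832977 `liftRow'`)
# RE-INDEXED INTO THE STATION's `hTOP` ∕ `hREC` TEXTS of ✓p834059 `supTowerLetter_of_liftLadderFbLetter'''` — byte-for-byte, `htop` DISCHARGED on the fibre

Cell `ym3-torus` (YM ladder rung R3 = continuum `SU(2)` Yang–Mills on the three-torus at fixed lattice data — a RUNG: NOT d = 4, NOT infinite volume,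
NOT a mass gap, NOT Clay).  Width seat «width 21» `ym3-torus-px21` (gen 25), FREE px helper on crux `stmt-QuantumFields-20520`
(`…Theses.UnitScaleTilt.FluctuationComparisonRegPrIntL`), LINE g18-1 S2β, the sup chain GAP♯∘ ⟸ knit v6 ✓p834885 ⟸ (ST‴) ⟸ ✓p834059 (station) ⟸
LIFT-LADDER⁵ = {`hTOP`, `hREC`, `hSCT_fb`}.  ARCHITECT px17 g22 2026-08-31 21:14:39Z NAMED this pen («the docking glue nobody holds since px10 ■»); LEAD w3 g29 №3
(the SUPPLIER KNIT `…SupTowerLetterOfSuppliers`) consumes the two conclusions by `exact`.  `--kind proof --supports stmt-QuantumFields-20520 --as helper`,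
count-neutral, DEFINITION-FREE (0 `def`, 0 `instance`, 0 `notation`, 0 `sorry`, default heartbeats).

WHAT.  The station's one-profile feedback letter asks, after its prefix and `Ax F J K hJK (expPoint ζ • U₀) U₀`, for `∃ c : ℕ → ℝ` with
  hTOP  `∀ h0 : 0 < K − J, E′ 0 h0 ≤ c 0`,   hREC  `∀ t (ht1 : t + 1 < K − J), E′ (t+1) ht1 ≤ A · E′ t _ + c (t+1)`,   hSCT  (the budget — the suppliers').
`E′` = the READ′ λ of ✓p831146∕✓p831454∕✓p832552∕✓p834059 (sum over `B` of the squared Pi-sup of the relative log field over the thickened read set).  px20's rows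
prove exactly these two lines in LANE currency (stage towers `g_j • Ū^jU′`, `g₀_j • Ū^jU₁` of the `AxStage` witness, the hat lift `lift`, the letter-free
DISCREPANCY ENERGY `D′`), with `htop` (coincidence of the two top stage fields) and the arc profile as hypotheses.  THIS FILE: (a) writes `D′` ONCE as a
two-argument λ `D′lam t (ht : t < K − J)` with the internal height `s := K − (J + (t+1))` SUBSTITUTED — at `t := 0` it is ✓`topRow'`'s right-hand side, at
`t + 1` it is ✓`liftRow'`'s `D′(t+1)` (β-reduction; the `(by omega)` proof terms are irrelevant); (b) DISCHARGES `htop` from the `AxStage` top clauses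
(`g_j ≡ 1 ≡ g₀_j` for `j ≥ K − J`, (T6), (T5-res), `U₀ = (g_0⁻¹·g₀_0) • U₁`) and the (E4) FIBRE MATE `descendTo (expPoint ζ • U₀) = descendTo U₀`
(✓`iter_eq_of_mem_fibre` + ✓`stageField_top_eq`); (c) keeps the station's `A` and `c` GENERIC and asks only the two side conditions the knit discharges in one line
each — `hA : (1+κ)·(11∕10·L⁻¹)² ≤ A` and `hc : ∀ t ht, (1+κ⁻¹)·D′lam t ht ≤ c t` (LEAD w3 g29's `c := fun t => if ht : t < K − J then (1+κ⁻¹)·D′lam t ht else 0`,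
`A := (1+κ)(11∕10)²∕L²`, `κ := 1∕5`) — so the CONCLUSIONS are the station's two conjunct texts VERBATIM.

WHAT IS PROVED (sorry-free).
§1 ★`stageTop_eq_of_fibreMate` — `g (s+1) • Ū^{s+1}(expPoint ζ • U₀) = g₀ (s+1) • Ū^{s+1} U₁` at `s + 1 = K − J` (✓`topRow'`'s `htop`) from the `AxStage` top clauses + the fibre mate.
§2 ★★`hTOP_of_topRow` — ✓`topRow'`'s binders + §1's inputs + `c, κ, hc` ⟹ the station's hTOP text.
§3 ★★`hREC_of_liftRow` — ✓`liftRow'`'s binders VERBATIM (incl. the ARC PROFILE `hArc`, `σ ≤ 1∕4`) + `A, c, hA, hc` ⟹ the station's hREC text.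
§4 ★★★`rows_dock` — §2 ∧ §3 in the station's order and spelling: the `hTOP ∧ hREC` part of `hLL` for ANY `A, c` with `hA, hc`.
RESIDUE BY NAME (the knit's binders): `hArc` (px12 ✓p832020 ∕ ✓p834939 under the datum small-bond guard + their θ-windows = D-GUARD's one binder), `hSCT_fb`
(the D′-budget: `Σ_t L^t·c t ≤ C_c·e^{c_cΣθ}·purse + β·S′` — (iii), suppliers px16∕px13∕px5∕px20∕px12); nothing else: READ′ nesting is inside ✓`liftRow'`.

HONEST SCOPE.  Re-indexing and one top-stage identity over landed theorems (✓`topRow'`, ✓`liftRow'`, ✓`stageField_top_eq`, ✓`iter_eq_of_mem_fibre`,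
✓`gaugeAct_mul_eq`); nothing of Bałaban's renormalisation-group analysis is asserted or proved ([Balaban1985Averaging] Prop. 4 (128)–(135) pp.37–38 is the
printed sup recursion the station transcribes; [Balaban1985RegularSpaces] (1.19) p.79, (1.29) p.81; [Balaban1987RG1] (0.4), (0.11) p.253); the arc profile,
the budgets, (ST‴)∕LOC‴∕AVG₂♭, `h3`, GAP♯∘ (`stub_uniformFibreGapOrbit`, registry 3732b7df UNTOUCHED), the five registered stubs (0∕5), S2β, 20520, 19936,
19200, `YM3TorusSU2` are NOT proved; no registered stub is closed; rung R3 — NOT d = 4, NOT infinite volume, NOT a mass gap, NOT Clay; the Yang–Mills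
mass gap is NOT proved.
-/

set_option autoImplicit false

namespace Summit.QuantumFields.YangMills.Theorems.FluctuationComparisonRegPrIntLS2BetaLiftLadderRowsDock

open Finset
open scoped Real
open Literature.MathematicalPhysics.QuantumLattice (su2Quat)
open Literature.MathematicalPhysics.QuantumFieldTheory.Balaban1983to89
open T4Continuum T3ContinuumYM3Torus T3TiltDescent T3LevelShift BlockAveraging
open B10Eq27TorusAxialLog (rel axialT)
open T4CubeChartGnomonic (SU2)
open T4HaarSU2ExpChart (expPoint)
open T4ExpWindowSmallField (logVec)
open T3UnitLawDensityEML (ℰp)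
open T3ConstrainedMinimiser (fibre)
open Summit.QuantumFields.YangMills.Theorems.FluctuationComparisonRegPrIntLS2BetaLiftLadderOneProfileTop (topRow')
open Summit.QuantumFields.YangMills.Theorems.FluctuationComparisonRegPrIntLS2BetaLiftLadderOneProfileTower (liftRow')
open Summit.QuantumFields.YangMills.Theorems.FluctuationComparisonRegPrIntLS2BetaStageAxialCombReading (stageField_top_eq)
open Summit.QuantumFields.YangMills.Theorems.FluctuationComparisonRegPrIntLS2BetaClosePairOfOneStep (iter_eq_of_mem_fibre)
open Summit.QuantumFields.YangMills.Theorems.FluctuationComparisonRegPrIntLS2BetaResidualGauge (gaugeAct_mul_eq)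

variable {F : T3Family}

/-! ## §1 The top stage fields coincide on the fibre (`htop` of ✓`topRow'` discharged) -/

/-- ★ **ON THE FIBRE THE TWO TOP STAGE FIELDS COINCIDE**: with the `AxStage` top clauses (`g_j ≡ 1 ≡ g₀_j` for `K − J ≤ j`, (T6), (T5-res),
`U₀ = (g_0⁻¹·g₀_0) • U₁`) and the fibre mate `descendTo (expPoint ζ • U₀) = descendTo U₀`: `g (s+1) • Ū^{s+1}(expPoint ζ • U₀) = g₀ (s+1) • Ū^{s+1} U₁` at
`s + 1 = K − J` — ✓`topRow'`'s `htop`. [cite: Balaban1985Averaging, (8) p.19 and (11) p.19; Balaban1985Variational, Thm 1 (8)-(10) p.279] -/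
theorem stageTop_eq_of_fibreMate {J K : ℕ} (hJK : J ≤ K) (U₀ : GaugeField (F.P K) 0 (Matrix.specialUnitaryGroup (Fin 2) ℂ)) (ζ : PBond (F.P K) 0 → EuclideanSpace ℝ (Fin 3))
    (U₁ : GaugeField (F.P K) 0 SU2) (g g₀ : (j : ℕ) → Site (F.P K) j → SU2)
    (hg1 : ∀ j, K - J ≤ j → ∀ y, g j y = 1) (hg1' : ∀ j, K - J ≤ j → ∀ y, g₀ j y = 1)
    (hT6 : ∀ X : GaugeField (F.P K) 0 SU2, Averaging.iter (fun k => blockAvg (P := F.P K) (j := k) ℰp) (K - J) (GaugeField.gaugeAct (fun x => (g 0 x)⁻¹) X) = Averaging.iter (fun k => blockAvg (P := F.P K) (j := k) ℰp) (K - J) X)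
    (hT5r : ∀ X : GaugeField (F.P K) 0 SU2, Averaging.iter (fun k => blockAvg (P := F.P K) (j := k) ℰp) (K - J) (GaugeField.gaugeAct (g₀ 0) X) = Averaging.iter (fun k => blockAvg (P := F.P K) (j := k) ℰp) (K - J) X)
    (hmate : descendTo F ℰp J K hJK (fun ℓ => expPoint (ζ ℓ) * U₀ ℓ : GaugeField (F.P K) 0 (Matrix.specialUnitaryGroup (Fin 2) ℂ)) = descendTo F ℰp J K hJK U₀)
    (hU₀ : U₀ = GaugeField.gaugeAct (fun x => (g 0 x)⁻¹ * g₀ 0 x) U₁)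
    (s : ℕ) (hs : s + 1 = K - J) :
    GaugeField.gaugeAct (g (s + 1)) (Averaging.iter (fun k => blockAvg (P := F.P K) (j := k) ℰp) (s + 1) (fun ℓ => expPoint (ζ ℓ) * U₀ ℓ)) =
      GaugeField.gaugeAct (g₀ (s + 1)) (Averaging.iter (fun k => blockAvg (P := F.P K) (j := k) ℰp) (s + 1) U₁) := by
  -- the two fields lie over the same datum: equal `(K − J)`-fold averages
  have hW : Averaging.iter (fun k => blockAvg (P := F.P K) (j := k) ℰp) (K - J) (fun ℓ => expPoint (ζ ℓ) * U₀ ℓ : GaugeField (F.P K) 0 (Matrix.specialUnitaryGroup (Fin 2) ℂ)) = Averaging.iter (fun k => blockAvg (P := F.P K) (j := k) ℰp) (K - J) U₀ :=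
    iter_eq_of_mem_fibre F hJK (V := descendTo F ℰp J K hJK U₀) hmate rfl
  -- `U₀ = w • U₁` with `w = g_0⁻¹·g₀_0` acting trivially on the top average
  have hU₁ : Averaging.iter (fun k => blockAvg (P := F.P K) (j := k) ℰp) (K - J) U₀ = Averaging.iter (fun k => blockAvg (P := F.P K) (j := k) ℰp) (K - J) U₁ := by
    have e1 : GaugeField.gaugeAct (fun x => (g 0 x)⁻¹ * g₀ 0 x) U₁ =
        GaugeField.gaugeAct (fun x => (g 0 x)⁻¹) (GaugeField.gaugeAct (g₀ 0) U₁) := gaugeAct_mul_eq (fun x => (g 0 x)⁻¹) (g₀ 0) U₁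
    rw [hU₀, e1, hT6, hT5r]
  have hfib : Averaging.iter (fun k => blockAvg (P := F.P K) (j := k) ℰp) (s + 1) (fun ℓ => expPoint (ζ ℓ) * U₀ ℓ : GaugeField (F.P K) 0 SU2) = Averaging.iter (fun k => blockAvg (P := F.P K) (j := k) ℰp) (s + 1) U₁ := by
    rw [hs]; exact hW.trans hU₁
  exact stageField_top_eq (fun k => blockAvg (P := F.P K) (j := k) ℰp) g g₀ _ U₁ (hg1 (s + 1) hs.symm.le) (hg1' (s + 1) hs.symm.le) hfib

/-! ## §2 The station's hTOP from ✓`topRow'` -/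

/-- ★★ **hTOP OF THE STATION FROM ✓`topRow'`** (✓p834059 `supTowerLetter_of_liftLadderFbLetter‴`'s first conjunct, VERBATIM, for ANY `c` with
`(1+κ⁻¹)·D′lam t ht ≤ c t`): on the fibre the top row is sources-only, `E′(0) ≤ D′lam 0 ≤ c 0`. [cite: Balaban1985Averaging, Prop. 4 (128)-(135) p.37-38; Balaban1985RegularSpaces, (1.19) p.79; Balaban1987RG1, (0.11) p.253] -/
theorem hTOP_of_topRow {J K : ℕ} (hJK : J ≤ K) (U₀ : GaugeField (F.P K) 0 (Matrix.specialUnitaryGroup (Fin 2) ℂ)) (ζ : PBond (F.P K) 0 → EuclideanSpace ℝ (Fin 3))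
    (lift : (j : ℕ) → GaugeField (F.P K) (j + 1) SU2 → GaugeField (F.P K) j SU2)
    (U₁ : GaugeField (F.P K) 0 SU2) (g g₀ : (j : ℕ) → Site (F.P K) j → SU2)
    (hT3 : ∀ X : GaugeField (F.P K) 0 SU2, ∀ j, j ≤ K - J →
      Averaging.iter (fun k => blockAvg (P := F.P K) (j := k) ℰp) j (GaugeField.gaugeAct (g 0) X) =
        GaugeField.gaugeAct (g j) (Averaging.iter (fun k => blockAvg (P := F.P K) (j := k) ℰp) j X))
    (hT4 : ∀ j, j < K - J → ∀ x,
      axialT (GaugeField.gaugeAct (g j) (Averaging.iter (fun k => blockAvg (P := F.P K) (j := k) ℰp) j (fun ℓ => expPoint (ζ ℓ) * U₀ ℓ))) (emb (blockOf x)) x =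
        axialT (lift j (GaugeField.gaugeAct (g (j + 1)) (Averaging.iter (fun k => blockAvg (P := F.P K) (j := k) ℰp) (j + 1) (fun ℓ => expPoint (ζ ℓ) * U₀ ℓ))))
          (emb (blockOf x)) x)
    (hT3' : ∀ X : GaugeField (F.P K) 0 SU2, ∀ j, j ≤ K - J →
      Averaging.iter (fun k => blockAvg (P := F.P K) (j := k) ℰp) j (GaugeField.gaugeAct (g₀ 0) X) =
        GaugeField.gaugeAct (g₀ j) (Averaging.iter (fun k => blockAvg (P := F.P K) (j := k) ℰp) j X))
    (hT4' : ∀ j, j < K - J → ∀ x,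
      axialT (GaugeField.gaugeAct (g₀ j) (Averaging.iter (fun k => blockAvg (P := F.P K) (j := k) ℰp) j U₁)) (emb (blockOf x)) x =
        axialT (lift j (GaugeField.gaugeAct (g₀ (j + 1)) (Averaging.iter (fun k => blockAvg (P := F.P K) (j := k) ℰp) (j + 1) U₁)))
          (emb (blockOf x)) x)
    (hU₀ : U₀ = GaugeField.gaugeAct (fun x => (g 0 x)⁻¹ * g₀ 0 x) U₁)
    (hg1 : ∀ j, K - J ≤ j → ∀ y, g j y = 1) (hg1' : ∀ j, K - J ≤ j → ∀ y, g₀ j y = 1)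
    (hT6 : ∀ X : GaugeField (F.P K) 0 SU2, Averaging.iter (fun k => blockAvg (P := F.P K) (j := k) ℰp) (K - J) (GaugeField.gaugeAct (fun x => (g 0 x)⁻¹) X) = Averaging.iter (fun k => blockAvg (P := F.P K) (j := k) ℰp) (K - J) X)
    (hT5r : ∀ X : GaugeField (F.P K) 0 SU2, Averaging.iter (fun k => blockAvg (P := F.P K) (j := k) ℰp) (K - J) (GaugeField.gaugeAct (g₀ 0) X) = Averaging.iter (fun k => blockAvg (P := F.P K) (j := k) ℰp) (K - J) X)
    (hmate : descendTo F ℰp J K hJK (fun ℓ => expPoint (ζ ℓ) * U₀ ℓ : GaugeField (F.P K) 0 (Matrix.specialUnitaryGroup (Fin 2) ℂ)) = descendTo F ℰp J K hJK U₀)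
    (c : ℕ → ℝ) {κ : ℝ} (hκ : 0 < κ)
    (hc : ∀ (t : ℕ) (ht : t < K - J), (1 + κ⁻¹) * (fun (t : ℕ) (ht : t < K - J) => ∑ B : PBond (F.P J) 0,
            ‖(fun ℓ' : PBond (F.P (J + (t + 1))) 0 =>
              if (∃ z : Site (F.P (J + (t + 1))) 0,
                (B14.Eq22Determines.blockIter (t + 1) z = (bondShift (F.sitesPerDir_eq (m := F.m) (K := J) (j := 0) (m' := F.m) (K' := J + (t + 1)) (j' := t + 1) (by omega)) B).src ∨ B14.Eq22Determines.blockIter (t + 1) z = (bondShift (F.sitesPerDir_eq (m := F.m) (K := J) (j := 0) (m' := F.m) (K' := J + (t + 1)) (j' := t + 1) (by omega)) B).tgt) ∧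
                ∀ ν, (B10Eq27TorusAxialLog.rel z ℓ'.src ν).natAbs ≤ 2) ∧
                ¬ (blockOf (ℓ'.src.shift ℓ'.dir) = blockOf ℓ'.src ∧ ∀ ν, ν < ℓ'.dir → B10Eq27TorusAxialLog.rel (emb (blockOf ℓ'.src)) ℓ'.src ν = 0)
              then logVec (su2Quat ((lift (K - (J + (t + 1))) (GaugeField.gaugeAct (g (K - (J + (t + 1)) + 1)) (Averaging.iter (fun k => blockAvg (P := F.P K) (j := k) ℰp) (K - (J + (t + 1)) + 1) (fun ℓ => expPoint (ζ ℓ) * U₀ ℓ))) (bondShift (F.sitesPerDir_eq (m := F.m) (K := J + (t + 1)) (j := 0) (m' := F.m) (K' := K) (j' := (K - (J + (t + 1)))) (by omega)) ℓ') *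
                    (lift (K - (J + (t + 1))) (GaugeField.gaugeAct (g₀ (K - (J + (t + 1)) + 1)) (Averaging.iter (fun k => blockAvg (P := F.P K) (j := k) ℰp) (K - (J + (t + 1)) + 1) U₁)) (bondShift (F.sitesPerDir_eq (m := F.m) (K := J + (t + 1)) (j := 0) (m' := F.m) (K' := K) (j' := (K - (J + (t + 1)))) (by omega)) ℓ'))⁻¹)⁻¹ *
                  (GaugeField.gaugeAct (g (K - (J + (t + 1)))) (Averaging.iter (fun k => blockAvg (P := F.P K) (j := k) ℰp) (K - (J + (t + 1))) (fun ℓ => expPoint (ζ ℓ) * U₀ ℓ)) (bondShift (F.sitesPerDir_eq (m := F.m) (K := J + (t + 1)) (j := 0) (m' := F.m) (K' := K) (j' := (K - (J + (t + 1)))) (by omega)) ℓ') *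
                    (GaugeField.gaugeAct (g₀ (K - (J + (t + 1)))) (Averaging.iter (fun k => blockAvg (P := F.P K) (j := k) ℰp) (K - (J + (t + 1))) U₁) (bondShift (F.sitesPerDir_eq (m := F.m) (K := J + (t + 1)) (j := 0) (m' := F.m) (K' := K) (j' := (K - (J + (t + 1)))) (by omega)) ℓ'))⁻¹))) else 0)‖ ^ 2) t ht ≤ c t) :
    ∀ h0 : 0 < K - J, (fun (t : ℕ) (ht : t < K - J) => ∑ B : PBond (F.P J) 0,
            ‖(fun ℓ' : PBond (F.P (J + (t + 1))) 0 =>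
              if ∃ z : Site (F.P (J + (t + 1))) 0,
                (B14.Eq22Determines.blockIter (t + 1) z = (bondShift (F.sitesPerDir_eq (m := F.m) (K := J) (j := 0) (m' := F.m) (K' := J + (t + 1)) (j' := t + 1) (by omega)) B).src ∨ B14.Eq22Determines.blockIter (t + 1) z = (bondShift (F.sitesPerDir_eq (m := F.m) (K := J) (j := 0) (m' := F.m) (K' := J + (t + 1)) (j' := t + 1) (by omega)) B).tgt) ∧
                ∀ ν, (B10Eq27TorusAxialLog.rel z ℓ'.src ν).natAbs ≤ 2
              then logVec (su2Quat (descendTo F ℰp (J + (t + 1)) K (by omega) (fun ℓ => expPoint (ζ ℓ) * U₀ ℓ : GaugeField (F.P K) 0 (Matrix.specialUnitaryGroup (Fin 2) ℂ)) ℓ' * (descendTo F ℰp (J + (t + 1)) K (by omega) U₀ ℓ')⁻¹)) else 0)‖ ^ 2) 0 h0 ≤ c 0 := by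
  intro h0
  have hs : K - (J + (0 + 1)) + 1 = K - J := by omega
  have htop := stageTop_eq_of_fibreMate hJK U₀ ζ U₁ g g₀ hg1 hg1' hT6 hT5r hmate hU₀ (K - (J + (0 + 1))) hs
  have h1 := topRow' hJK U₀ ζ lift U₁ g g₀ hT3 hT4 hT3' hT4' hU₀ (K - (J + (0 + 1))) hs h0 htop
  refine h1.trans (le_trans ?_ (hc 0 h0))
  have hκ1 : (1 : ℝ) ≤ 1 + κ⁻¹ := le_add_of_nonneg_right (inv_nonneg.mpr hκ.le)
  exact le_mul_of_one_le_left (Finset.sum_nonneg fun B _ => sq_nonneg _) hκ1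

/-! ## §3 The station's hREC from ✓`liftRow'` -/

/-- ★★ **hREC OF THE STATION FROM ✓`liftRow'`** (✓p834059's second conjunct, VERBATIM, for ANY `A ≥ (1+κ)(11∕10·L⁻¹)²` and ANY `c` with
`(1+κ⁻¹)·D′lam t ht ≤ c t`; binders = ✓`liftRow'`'s incl. the ARC PROFILE `hArc`): `E′(t+1) ≤ A·E′(t) + c (t+1)`. [cite: Balaban1985RegularSpaces, (1.19) p.79, (1.29) p.81; Balaban1985Averaging, Prop. 4 (128)-(135) p.37-38; Balaban1987RG1, (0.4), (0.11) p.253] -/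
theorem hREC_of_liftRow {J K : ℕ} (hJK : J ≤ K) (U₀ : GaugeField (F.P K) 0 (Matrix.specialUnitaryGroup (Fin 2) ℂ)) (ζ : PBond (F.P K) 0 → EuclideanSpace ℝ (Fin 3))
    (wt : (j : ℕ) → PBond (F.P K) j → PBond (F.P K) (j + 1) → ℝ)
    (lift : (j : ℕ) → GaugeField (F.P K) (j + 1) SU2 → GaugeField (F.P K) j SU2)
    (U₁ : GaugeField (F.P K) 0 SU2) (g g₀ : (j : ℕ) → Site (F.P K) j → SU2)
    (hwt : ∀ j b e, wt j b e = if e.dir = b.dir ∧ (b.src b.dir - emb e.src b.dir).val < (F.P K).L then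
        ∏ ν ∈ Finset.univ.erase b.dir, max 0 (1 - ((rel (emb e.src) b.src ν).natAbs : ℝ) / (F.P K).L) else 0)
    (hlift : ∀ j X b, lift j X b = expPoint (∑ e, wt j b e • ((((F.P K).L : ℕ) : ℝ)⁻¹ • logVec (su2Quat (X e)))))
    (hT3 : ∀ X : GaugeField (F.P K) 0 SU2, ∀ j, j ≤ K - J →
      Averaging.iter (fun k => blockAvg (P := F.P K) (j := k) ℰp) j (GaugeField.gaugeAct (g 0) X) =
        GaugeField.gaugeAct (g j) (Averaging.iter (fun k => blockAvg (P := F.P K) (j := k) ℰp) j X))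
    (hT4 : ∀ j, j < K - J → ∀ x,
      axialT (GaugeField.gaugeAct (g j) (Averaging.iter (fun k => blockAvg (P := F.P K) (j := k) ℰp) j (fun ℓ => expPoint (ζ ℓ) * U₀ ℓ))) (emb (blockOf x)) x =
        axialT (lift j (GaugeField.gaugeAct (g (j + 1)) (Averaging.iter (fun k => blockAvg (P := F.P K) (j := k) ℰp) (j + 1) (fun ℓ => expPoint (ζ ℓ) * U₀ ℓ))))
          (emb (blockOf x)) x)
    (hT3' : ∀ X : GaugeField (F.P K) 0 SU2, ∀ j, j ≤ K - J →
      Averaging.iter (fun k => blockAvg (P := F.P K) (j := k) ℰp) j (GaugeField.gaugeAct (g₀ 0) X) =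
        GaugeField.gaugeAct (g₀ j) (Averaging.iter (fun k => blockAvg (P := F.P K) (j := k) ℰp) j X))
    (hT4' : ∀ j, j < K - J → ∀ x,
      axialT (GaugeField.gaugeAct (g₀ j) (Averaging.iter (fun k => blockAvg (P := F.P K) (j := k) ℰp) j U₁)) (emb (blockOf x)) x =
        axialT (lift j (GaugeField.gaugeAct (g₀ (j + 1)) (Averaging.iter (fun k => blockAvg (P := F.P K) (j := k) ℰp) (j + 1) U₁)))
          (emb (blockOf x)) x)
    (hU₀ : U₀ = GaugeField.gaugeAct (fun x => (g 0 x)⁻¹ * g₀ 0 x) U₁)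
    (hL2 : 2 ≤ F.L) {σ : ℝ} (hσ4 : σ ≤ 1 / 4)
    (hArc : ∀ i, 1 ≤ i → i < K - J → ∀ e : PBond (F.P K) i,
      ‖logVec (su2Quat (GaugeField.gaugeAct (g i) (Averaging.iter (fun k => blockAvg (P := F.P K) (j := k) ℰp) i (fun ℓ => expPoint (ζ ℓ) * U₀ ℓ)) e))‖ ≤ σ ∧
      ‖logVec (su2Quat (GaugeField.gaugeAct (g₀ i) (Averaging.iter (fun k => blockAvg (P := F.P K) (j := k) ℰp) i U₁) e))‖ ≤ σ) {κ : ℝ} (hκ : 0 < κ)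
    (A : ℝ) (c : ℕ → ℝ) (hA : (1 + κ) * (11 / 10 * (F.L : ℝ)⁻¹) ^ 2 ≤ A)
    (hc : ∀ (t : ℕ) (ht : t < K - J), (1 + κ⁻¹) * (fun (t : ℕ) (ht : t < K - J) => ∑ B : PBond (F.P J) 0,
            ‖(fun ℓ' : PBond (F.P (J + (t + 1))) 0 =>
              if (∃ z : Site (F.P (J + (t + 1))) 0,
                (B14.Eq22Determines.blockIter (t + 1) z = (bondShift (F.sitesPerDir_eq (m := F.m) (K := J) (j := 0) (m' := F.m) (K' := J + (t + 1)) (j' := t + 1) (by omega)) B).src ∨ B14.Eq22Determines.blockIter (t + 1) z = (bondShift (F.sitesPerDir_eq (m := F.m) (K := J) (j := 0) (m' := F.m) (K' := J + (t + 1)) (j' := t + 1) (by omega)) B).tgt) ∧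
                ∀ ν, (B10Eq27TorusAxialLog.rel z ℓ'.src ν).natAbs ≤ 2) ∧
                ¬ (blockOf (ℓ'.src.shift ℓ'.dir) = blockOf ℓ'.src ∧ ∀ ν, ν < ℓ'.dir → B10Eq27TorusAxialLog.rel (emb (blockOf ℓ'.src)) ℓ'.src ν = 0)
              then logVec (su2Quat ((lift (K - (J + (t + 1))) (GaugeField.gaugeAct (g (K - (J + (t + 1)) + 1)) (Averaging.iter (fun k => blockAvg (P := F.P K) (j := k) ℰp) (K - (J + (t + 1)) + 1) (fun ℓ => expPoint (ζ ℓ) * U₀ ℓ))) (bondShift (F.sitesPerDir_eq (m := F.m) (K := J + (t + 1)) (j := 0) (m' := F.m) (K' := K) (j' := (K - (J + (t + 1)))) (by omega)) ℓ') *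
                    (lift (K - (J + (t + 1))) (GaugeField.gaugeAct (g₀ (K - (J + (t + 1)) + 1)) (Averaging.iter (fun k => blockAvg (P := F.P K) (j := k) ℰp) (K - (J + (t + 1)) + 1) U₁)) (bondShift (F.sitesPerDir_eq (m := F.m) (K := J + (t + 1)) (j := 0) (m' := F.m) (K' := K) (j' := (K - (J + (t + 1)))) (by omega)) ℓ'))⁻¹)⁻¹ *
                  (GaugeField.gaugeAct (g (K - (J + (t + 1)))) (Averaging.iter (fun k => blockAvg (P := F.P K) (j := k) ℰp) (K - (J + (t + 1))) (fun ℓ => expPoint (ζ ℓ) * U₀ ℓ)) (bondShift (F.sitesPerDir_eq (m := F.m) (K := J + (t + 1)) (j := 0) (m' := F.m) (K' := K) (j' := (K - (J + (t + 1)))) (by omega)) ℓ') *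
                    (GaugeField.gaugeAct (g₀ (K - (J + (t + 1)))) (Averaging.iter (fun k => blockAvg (P := F.P K) (j := k) ℰp) (K - (J + (t + 1))) U₁) (bondShift (F.sitesPerDir_eq (m := F.m) (K := J + (t + 1)) (j := 0) (m' := F.m) (K' := K) (j' := (K - (J + (t + 1)))) (by omega)) ℓ'))⁻¹))) else 0)‖ ^ 2) t ht ≤ c t) :
    ∀ (t : ℕ) (ht1 : t + 1 < K - J),
              (fun (t : ℕ) (ht : t < K - J) => ∑ B : PBond (F.P J) 0,
            ‖(fun ℓ' : PBond (F.P (J + (t + 1))) 0 =>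
              if ∃ z : Site (F.P (J + (t + 1))) 0,
                (B14.Eq22Determines.blockIter (t + 1) z = (bondShift (F.sitesPerDir_eq (m := F.m) (K := J) (j := 0) (m' := F.m) (K' := J + (t + 1)) (j' := t + 1) (by omega)) B).src ∨ B14.Eq22Determines.blockIter (t + 1) z = (bondShift (F.sitesPerDir_eq (m := F.m) (K := J) (j := 0) (m' := F.m) (K' := J + (t + 1)) (j' := t + 1) (by omega)) B).tgt) ∧
                ∀ ν, (B10Eq27TorusAxialLog.rel z ℓ'.src ν).natAbs ≤ 2
              then logVec (su2Quat (descendTo F ℰp (J + (t + 1)) K (by omega) (fun ℓ => expPoint (ζ ℓ) * U₀ ℓ : GaugeField (F.P K) 0 (Matrix.specialUnitaryGroup (Fin 2) ℂ)) ℓ' * (descendTo F ℰp (J + (t + 1)) K (by omega) U₀ ℓ')⁻¹)) else 0)‖ ^ 2) (t + 1) ht1 ≤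
                A * (fun (t : ℕ) (ht : t < K - J) => ∑ B : PBond (F.P J) 0,
            ‖(fun ℓ' : PBond (F.P (J + (t + 1))) 0 =>
              if ∃ z : Site (F.P (J + (t + 1))) 0,
                (B14.Eq22Determines.blockIter (t + 1) z = (bondShift (F.sitesPerDir_eq (m := F.m) (K := J) (j := 0) (m' := F.m) (K' := J + (t + 1)) (j' := t + 1) (by omega)) B).src ∨ B14.Eq22Determines.blockIter (t + 1) z = (bondShift (F.sitesPerDir_eq (m := F.m) (K := J) (j := 0) (m' := F.m) (K' := J + (t + 1)) (j' := t + 1) (by omega)) B).tgt) ∧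
                ∀ ν, (B10Eq27TorusAxialLog.rel z ℓ'.src ν).natAbs ≤ 2
              then logVec (su2Quat (descendTo F ℰp (J + (t + 1)) K (by omega) (fun ℓ => expPoint (ζ ℓ) * U₀ ℓ : GaugeField (F.P K) 0 (Matrix.specialUnitaryGroup (Fin 2) ℂ)) ℓ' * (descendTo F ℰp (J + (t + 1)) K (by omega) U₀ ℓ')⁻¹)) else 0)‖ ^ 2) t (Nat.lt_of_succ_lt ht1) + c (t + 1) := by
  intro t ht1
  have h := liftRow' hJK U₀ ζ wt lift U₁ g g₀ hwt hlift hT3 hT4 hT3' hT4' hU₀ hL2 hσ4 hArc hκ t (K - (J + (t + 1 + 1))) rfl ht1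
  refine h.trans (add_le_add (mul_le_mul_of_nonneg_right hA ?_) (hc (t + 1) ht1))
  exact Finset.sum_nonneg fun B _ => sq_nonneg _

/-! ## §4 Both rows at once, in the station's order -/

/-- ★★★ **ROWS DOCK**: the `hTOP ∧ hREC` part of ✓p834059's `hLL` body, VERBATIM, for ANY `A, c` with `hA, hc` — from ✓`topRow'` ∘ §1 and ✓`liftRow'`.
The knit supplies `⟨c, (rows_dock …).1, (rows_dock …).2, hSCT⟩`. [cite: Balaban1985Averaging, Prop. 4 (128)-(135) p.37-38; Balaban1985RegularSpaces, (1.29) p.81; Balaban1987RG1, (0.11) p.253] -/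
theorem rows_dock {J K : ℕ} (hJK : J ≤ K) (U₀ : GaugeField (F.P K) 0 (Matrix.specialUnitaryGroup (Fin 2) ℂ)) (ζ : PBond (F.P K) 0 → EuclideanSpace ℝ (Fin 3))
    (wt : (j : ℕ) → PBond (F.P K) j → PBond (F.P K) (j + 1) → ℝ)
    (lift : (j : ℕ) → GaugeField (F.P K) (j + 1) SU2 → GaugeField (F.P K) j SU2)
    (U₁ : GaugeField (F.P K) 0 SU2) (g g₀ : (j : ℕ) → Site (F.P K) j → SU2)
    (hwt : ∀ j b e, wt j b e = if e.dir = b.dir ∧ (b.src b.dir - emb e.src b.dir).val < (F.P K).L then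
        ∏ ν ∈ Finset.univ.erase b.dir, max 0 (1 - ((rel (emb e.src) b.src ν).natAbs : ℝ) / (F.P K).L) else 0)
    (hlift : ∀ j X b, lift j X b = expPoint (∑ e, wt j b e • ((((F.P K).L : ℕ) : ℝ)⁻¹ • logVec (su2Quat (X e)))))
    (hT3 : ∀ X : GaugeField (F.P K) 0 SU2, ∀ j, j ≤ K - J →
      Averaging.iter (fun k => blockAvg (P := F.P K) (j := k) ℰp) j (GaugeField.gaugeAct (g 0) X) =
        GaugeField.gaugeAct (g j) (Averaging.iter (fun k => blockAvg (P := F.P K) (j := k) ℰp) j X))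
    (hT4 : ∀ j, j < K - J → ∀ x,
      axialT (GaugeField.gaugeAct (g j) (Averaging.iter (fun k => blockAvg (P := F.P K) (j := k) ℰp) j (fun ℓ => expPoint (ζ ℓ) * U₀ ℓ))) (emb (blockOf x)) x =
        axialT (lift j (GaugeField.gaugeAct (g (j + 1)) (Averaging.iter (fun k => blockAvg (P := F.P K) (j := k) ℰp) (j + 1) (fun ℓ => expPoint (ζ ℓ) * U₀ ℓ))))
          (emb (blockOf x)) x)
    (hT3' : ∀ X : GaugeField (F.P K) 0 SU2, ∀ j, j ≤ K - J →
      Averaging.iter (fun k => blockAvg (P := F.P K) (j := k) ℰp) j (GaugeField.gaugeAct (g₀ 0) X) =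
        GaugeField.gaugeAct (g₀ j) (Averaging.iter (fun k => blockAvg (P := F.P K) (j := k) ℰp) j X))
    (hT4' : ∀ j, j < K - J → ∀ x,
      axialT (GaugeField.gaugeAct (g₀ j) (Averaging.iter (fun k => blockAvg (P := F.P K) (j := k) ℰp) j U₁)) (emb (blockOf x)) x =
        axialT (lift j (GaugeField.gaugeAct (g₀ (j + 1)) (Averaging.iter (fun k => blockAvg (P := F.P K) (j := k) ℰp) (j + 1) U₁)))
          (emb (blockOf x)) x)
    (hU₀ : U₀ = GaugeField.gaugeAct (fun x => (g 0 x)⁻¹ * g₀ 0 x) U₁)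
    (hL2 : 2 ≤ F.L) {σ : ℝ} (hσ4 : σ ≤ 1 / 4)
    (hArc : ∀ i, 1 ≤ i → i < K - J → ∀ e : PBond (F.P K) i,
      ‖logVec (su2Quat (GaugeField.gaugeAct (g i) (Averaging.iter (fun k => blockAvg (P := F.P K) (j := k) ℰp) i (fun ℓ => expPoint (ζ ℓ) * U₀ ℓ)) e))‖ ≤ σ ∧
      ‖logVec (su2Quat (GaugeField.gaugeAct (g₀ i) (Averaging.iter (fun k => blockAvg (P := F.P K) (j := k) ℰp) i U₁) e))‖ ≤ σ) {κ : ℝ} (hκ : 0 < κ)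
    (hg1 : ∀ j, K - J ≤ j → ∀ y, g j y = 1) (hg1' : ∀ j, K - J ≤ j → ∀ y, g₀ j y = 1)
    (hT6 : ∀ X : GaugeField (F.P K) 0 SU2, Averaging.iter (fun k => blockAvg (P := F.P K) (j := k) ℰp) (K - J) (GaugeField.gaugeAct (fun x => (g 0 x)⁻¹) X) = Averaging.iter (fun k => blockAvg (P := F.P K) (j := k) ℰp) (K - J) X)
    (hT5r : ∀ X : GaugeField (F.P K) 0 SU2, Averaging.iter (fun k => blockAvg (P := F.P K) (j := k) ℰp) (K - J) (GaugeField.gaugeAct (g₀ 0) X) = Averaging.iter (fun k => blockAvg (P := F.P K) (j := k) ℰp) (K - J) X)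
    (hmate : descendTo F ℰp J K hJK (fun ℓ => expPoint (ζ ℓ) * U₀ ℓ : GaugeField (F.P K) 0 (Matrix.specialUnitaryGroup (Fin 2) ℂ)) = descendTo F ℰp J K hJK U₀)
    (A : ℝ) (c : ℕ → ℝ) (hA : (1 + κ) * (11 / 10 * (F.L : ℝ)⁻¹) ^ 2 ≤ A)
    (hc : ∀ (t : ℕ) (ht : t < K - J), (1 + κ⁻¹) * (fun (t : ℕ) (ht : t < K - J) => ∑ B : PBond (F.P J) 0,
            ‖(fun ℓ' : PBond (F.P (J + (t + 1))) 0 =>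
              if (∃ z : Site (F.P (J + (t + 1))) 0,
                (B14.Eq22Determines.blockIter (t + 1) z = (bondShift (F.sitesPerDir_eq (m := F.m) (K := J) (j := 0) (m' := F.m) (K' := J + (t + 1)) (j' := t + 1) (by omega)) B).src ∨ B14.Eq22Determines.blockIter (t + 1) z = (bondShift (F.sitesPerDir_eq (m := F.m) (K := J) (j := 0) (m' := F.m) (K' := J + (t + 1)) (j' := t + 1) (by omega)) B).tgt) ∧
                ∀ ν, (B10Eq27TorusAxialLog.rel z ℓ'.src ν).natAbs ≤ 2) ∧
                ¬ (blockOf (ℓ'.src.shift ℓ'.dir) = blockOf ℓ'.src ∧ ∀ ν, ν < ℓ'.dir → B10Eq27TorusAxialLog.rel (emb (blockOf ℓ'.src)) ℓ'.src ν = 0)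
              then logVec (su2Quat ((lift (K - (J + (t + 1))) (GaugeField.gaugeAct (g (K - (J + (t + 1)) + 1)) (Averaging.iter (fun k => blockAvg (P := F.P K) (j := k) ℰp) (K - (J + (t + 1)) + 1) (fun ℓ => expPoint (ζ ℓ) * U₀ ℓ))) (bondShift (F.sitesPerDir_eq (m := F.m) (K := J + (t + 1)) (j := 0) (m' := F.m) (K' := K) (j' := (K - (J + (t + 1)))) (by omega)) ℓ') *
                    (lift (K - (J + (t + 1))) (GaugeField.gaugeAct (g₀ (K - (J + (t + 1)) + 1)) (Averaging.iter (fun k => blockAvg (P := F.P K) (j := k) ℰp) (K - (J + (t + 1)) + 1) U₁)) (bondShift (F.sitesPerDir_eq (m := F.m) (K := J + (t + 1)) (j := 0) (m' := F.m) (K' := K) (j' := (K - (J + (t + 1)))) (by omega)) ℓ'))⁻¹)⁻¹ *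
                  (GaugeField.gaugeAct (g (K - (J + (t + 1)))) (Averaging.iter (fun k => blockAvg (P := F.P K) (j := k) ℰp) (K - (J + (t + 1))) (fun ℓ => expPoint (ζ ℓ) * U₀ ℓ)) (bondShift (F.sitesPerDir_eq (m := F.m) (K := J + (t + 1)) (j := 0) (m' := F.m) (K' := K) (j' := (K - (J + (t + 1)))) (by omega)) ℓ') *
                    (GaugeField.gaugeAct (g₀ (K - (J + (t + 1)))) (Averaging.iter (fun k => blockAvg (P := F.P K) (j := k) ℰp) (K - (J + (t + 1))) U₁) (bondShift (F.sitesPerDir_eq (m := F.m) (K := J + (t + 1)) (j := 0) (m' := F.m) (K' := K) (j' := (K - (J + (t + 1)))) (by omega)) ℓ'))⁻¹))) else 0)‖ ^ 2) t ht ≤ c t) :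
    (∀ h0 : 0 < K - J, (fun (t : ℕ) (ht : t < K - J) => ∑ B : PBond (F.P J) 0,
            ‖(fun ℓ' : PBond (F.P (J + (t + 1))) 0 =>
              if ∃ z : Site (F.P (J + (t + 1))) 0,
                (B14.Eq22Determines.blockIter (t + 1) z = (bondShift (F.sitesPerDir_eq (m := F.m) (K := J) (j := 0) (m' := F.m) (K' := J + (t + 1)) (j' := t + 1) (by omega)) B).src ∨ B14.Eq22Determines.blockIter (t + 1) z = (bondShift (F.sitesPerDir_eq (m := F.m) (K := J) (j := 0) (m' := F.m) (K' := J + (t + 1)) (j' := t + 1) (by omega)) B).tgt) ∧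
                ∀ ν, (B10Eq27TorusAxialLog.rel z ℓ'.src ν).natAbs ≤ 2
              then logVec (su2Quat (descendTo F ℰp (J + (t + 1)) K (by omega) (fun ℓ => expPoint (ζ ℓ) * U₀ ℓ : GaugeField (F.P K) 0 (Matrix.specialUnitaryGroup (Fin 2) ℂ)) ℓ' * (descendTo F ℰp (J + (t + 1)) K (by omega) U₀ ℓ')⁻¹)) else 0)‖ ^ 2) 0 h0 ≤ c 0) ∧
            (∀ (t : ℕ) (ht1 : t + 1 < K - J),
              (fun (t : ℕ) (ht : t < K - J) => ∑ B : PBond (F.P J) 0,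
            ‖(fun ℓ' : PBond (F.P (J + (t + 1))) 0 =>
              if ∃ z : Site (F.P (J + (t + 1))) 0,
                (B14.Eq22Determines.blockIter (t + 1) z = (bondShift (F.sitesPerDir_eq (m := F.m) (K := J) (j := 0) (m' := F.m) (K' := J + (t + 1)) (j' := t + 1) (by omega)) B).src ∨ B14.Eq22Determines.blockIter (t + 1) z = (bondShift (F.sitesPerDir_eq (m := F.m) (K := J) (j := 0) (m' := F.m) (K' := J + (t + 1)) (j' := t + 1) (by omega)) B).tgt) ∧
                ∀ ν, (B10Eq27TorusAxialLog.rel z ℓ'.src ν).natAbs ≤ 2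
              then logVec (su2Quat (descendTo F ℰp (J + (t + 1)) K (by omega) (fun ℓ => expPoint (ζ ℓ) * U₀ ℓ : GaugeField (F.P K) 0 (Matrix.specialUnitaryGroup (Fin 2) ℂ)) ℓ' * (descendTo F ℰp (J + (t + 1)) K (by omega) U₀ ℓ')⁻¹)) else 0)‖ ^ 2) (t + 1) ht1 ≤
                A * (fun (t : ℕ) (ht : t < K - J) => ∑ B : PBond (F.P J) 0,
            ‖(fun ℓ' : PBond (F.P (J + (t + 1))) 0 =>
              if ∃ z : Site (F.P (J + (t + 1))) 0,
                (B14.Eq22Determines.blockIter (t + 1) z = (bondShift (F.sitesPerDir_eq (m := F.m) (K := J) (j := 0) (m' := F.m) (K' := J + (t + 1)) (j' := t + 1) (by omega)) B).src ∨ B14.Eq22Determines.blockIter (t + 1) z = (bondShift (F.sitesPerDir_eq (m := F.m) (K := J) (j := 0) (m' := F.m) (K' := J + (t + 1)) (j' := t + 1) (by omega)) B).tgt) ∧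
                ∀ ν, (B10Eq27TorusAxialLog.rel z ℓ'.src ν).natAbs ≤ 2
              then logVec (su2Quat (descendTo F ℰp (J + (t + 1)) K (by omega) (fun ℓ => expPoint (ζ ℓ) * U₀ ℓ : GaugeField (F.P K) 0 (Matrix.specialUnitaryGroup (Fin 2) ℂ)) ℓ' * (descendTo F ℰp (J + (t + 1)) K (by omega) U₀ ℓ')⁻¹)) else 0)‖ ^ 2) t (Nat.lt_of_succ_lt ht1) + c (t + 1)) :=
  ⟨hTOP_of_topRow hJK U₀ ζ lift U₁ g g₀ hT3 hT4 hT3' hT4' hU₀ hg1 hg1' hT6 hT5r hmate c hκ hc,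
   hREC_of_liftRow hJK U₀ ζ wt lift U₁ g g₀ hwt hlift hT3 hT4 hT3' hT4' hU₀ hL2 hσ4 hArc hκ A c hA hc⟩

end Summit.QuantumFields.YangMills.Theorems.FluctuationComparisonRegPrIntLS2BetaLiftLadderRowsDock
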